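import Mathlib
import Literature.Analysis.FluidPDE.ClassicalSolution
import Literature.Analysis.FluidPDE.LerayHopf
import Literature.Analysis.FluidPDE.NSWave0
import Literature.Analysis.FluidPDE.SobolevWholeSpace
import Literature.Analysis.FluidPDE.CKNInterpolationEstimate
import Literature.Analysis.FluidPDE.TaoEnstrophyLocalisationProofs
import Literature.Analysis.FluidPDE.SereginSverakPressureLocalTypeI
import Literature.Analysis.FluidPDE.NSSereginMildCompactness
import Summits.NavierStokesRegularity.NavierStokesRegularity.Theses.L3TimeExponentPincer
import HarnessLib.Audit
import HarnessLib

/-!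
# The energy-level floor `q = 4` of the jaw (route `L3TimeExponentPincer`, crux `L3CascadeJaw`):
# every frame solution is a priori in `L⁴_t L³_x`

Support file for `stmt-NavierStokesRegularity-19499` (`L3CascadeJaw`, the attacked conjunct of route
`L3TimeExponentPincer`; cell ns-regularity-ideate, seat p4).  The crux asks, for every `q ∈ (4,5)`, that
every classical solution on `[0,T)`, Leray–Hopf from a rapidly decaying datum, has `∫ ‖u(t)‖₃^q dt < ∞`
on a final window.  The route's NUMBERS section records the KNOWN floor of that scale — "every
Leray–Hopf solution is a priori in `L⁴_t L³_x` (energy × enstrophy, interpolation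
`‖u‖₃⁴ ≤ ‖u‖₂²‖u‖₆² ≤ C E ‖∇u‖₂²`)" — which was not yet a tree theorem.  It is proved here, for the
route's frame and with explicit constants:

* `eLpNorm_three_rpow_four_le` — slice inequality `‖w‖₃⁴ ≤ ‖w‖₂² · K² ∫ |∇w|²` for a `C¹` field
  `w : ℝ³ → ℝ³` with `w ∈ L²` (Lebesgue interpolation `∫|w|³ ≤ (∫|w|²)^{3/4}(∫|w|⁶)^{1/4}`,
  `lintegral_pow_three_le_Lp_interpolation`, and the whole-space Sobolev inequality `‖w‖₆ ≤ K ‖Dw‖₂`,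
  `eLpNorm_six_le_eLpNorm_fderiv_two`, `K = SNormLESNormFDerivOfEqConst ℝ³ volume 2`; operator norm
  `≤` Frobenius norm, `sq_opNorm_le_frobeniusNormSq`);
* `lintegral_eLpNorm_three_rpow_four_lt_top` — **`∫₀ᵀ ‖u(t)‖₃⁴ dt < ∞`** for every classical solution on
  `[0,T)` that is Leray–Hopf on `[0,T)` (energy bound `∫|u(t)|² ≤ 2E(u₀)`,
  `IsLerayHopfOn.lintegral_enorm_sq_le`; finite dissipation of the classical gradient on the slab,
  `SereginSverak2002.lintegral_slab_frobeniusNormSq_fderiv_lt_top'`; Tonelli);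
* `l3Jaw_four` — the jaw statement of the crux with `q = 4` (whole interval, no final window needed),
  in the crux's exact frame: the calibration "`L3CascadeJaw` = energy level `+ ε` in the time exponent".

References: J. C. Robinson, J. L. Rodrigo, W. Sadowski, *The three-dimensional Navier–Stokes equations*
(2016), Lemma 3.5 (interpolation) and the `L^r_t L^s_x` scale of Leray–Hopf solutions, `2/r + 3/s = 3/2`
(here `r = 4`, `s = 3`); L. C. Evans, *PDE*, §5.6.1 (Gagliardo–Nirenberg–Sobolev).

WHAT THIS IS NOT: not a claim about Navier–Stokes regularity or blow-up and not progress on the crux beyond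
its known floor; a kernel-checked a priori estimate, landed `--supports` as a helper.
-/

noncomputable section

namespace Summit.NavierStokesRegularity.NavierStokesRegularity.Theorems.L3TimeExponentPincerJawEnergyFloor

open MeasureTheory Set Function Filter Metric Topology TopologicalSpace
open scoped ENNReal NNReal
open Literature.Analysis.FluidPDE

/-- `‖f‖_{L^p}^p = ∫ ‖f‖ₑ^p` for `p = 3, 6` written with a real exponent on the integrand. [folklore] -/
theorem eLpNorm_rpow_eq_lintegral {α F : Type*} [MeasurableSpace α] [NormedAddCommGroup F]
    (μ : Measure α) (f : α → F) {p : ℝ} (hp : 0 < p) :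
    eLpNorm f (ENNReal.ofReal p) μ ^ p = ∫⁻ x, ‖f x‖ₑ ^ p ∂μ := by
  have hp0 : ENNReal.ofReal p ≠ 0 := (ENNReal.ofReal_pos.2 hp).ne'
  rw [eLpNorm_eq_lintegral_rpow_enorm_toReal hp0 ENNReal.ofReal_ne_top, ENNReal.toReal_ofReal hp.le,
    ← ENNReal.rpow_mul, one_div, inv_mul_cancel₀ hp.ne', ENNReal.rpow_one]

/-- **Slice inequality `‖w‖₃⁴ ≤ ‖w‖₂² · K² ∫ |∇w|²`** for a `C¹` field `w : ℝ³ → ℝ³` with `w ∈ L²`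
(`K = SNormLESNormFDerivOfEqConst ℝ³ volume 2`): Lebesgue interpolation
`∫|w|³ ≤ (∫|w|²)^{3/4}(∫|w|⁶)^{1/4}` and the Gagliardo–Nirenberg–Sobolev inequality `‖w‖₆ ≤ K‖Dw‖₂`,
with `‖Dw‖² ≤ |∇w|²` (operator vs Frobenius norm). [cite: RobinsonRodrigoSadowski2016, Lemma 3.5]
[cite: Evans2010, §5.6.1 Thm. 1–2] -/
theorem eLpNorm_three_rpow_four_le {w : EuclideanSpace ℝ (Fin 3) → EuclideanSpace ℝ (Fin 3)}
    (hw : ContDiff ℝ 1 w) (h2 : ∫⁻ x, ‖w x‖ₑ ^ 2 < ⊤) :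
    eLpNorm w 3 volume ^ (4 : ℝ) ≤
      (∫⁻ x, ‖w x‖ₑ ^ 2) *
        (((SNormLESNormFDerivOfEqConst (EuclideanSpace ℝ (Fin 3))
            (volume : Measure (EuclideanSpace ℝ (Fin 3))) 2 : ℝ≥0) : ℝ≥0∞) ^ 2 *
          ∫⁻ x, ENNReal.ofReal (frobeniusNormSq (fderiv ℝ w x))) := by
  have hmeas : AEMeasurable (fun x => ‖w x‖ₑ) (volume : Measure (EuclideanSpace ℝ (Fin 3))) :=
    hw.continuous.measurable.enorm.aemeasurable
  -- interpolation `∫|w|³ ≤ (∫|w|²)^{3/4} (∫|w|⁶)^{1/4}`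
  have hint := lintegral_pow_three_le_Lp_interpolation volume hmeas
  -- `‖w‖₃⁴ = (∫|w|³)^{4/3}`
  have e3 : eLpNorm w 3 volume ^ (4 : ℝ) = (∫⁻ x, ‖w x‖ₑ ^ (3 : ℕ)) ^ (4 / 3 : ℝ) := by
    have h1 : eLpNorm w 3 volume ^ (3 : ℝ) = ∫⁻ x, ‖w x‖ₑ ^ (3 : ℕ) := by
      have h := eLpNorm_rpow_eq_lintegral volume w (p := 3) (by norm_num)
      rw [show ENNReal.ofReal (3 : ℝ) = 3 by norm_num] at h
      rw [h]
      refine lintegral_congr fun x => ?_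
      rw [show (3 : ℝ) = ((3 : ℕ) : ℝ) by norm_num, ENNReal.rpow_natCast]
    rw [← h1, ← ENNReal.rpow_mul]
    norm_num
  -- `(A2^{3/4} A6^{1/4})^{4/3} = A2 · A6^{1/3}`
  have e4 : ((∫⁻ x, ‖w x‖ₑ ^ (2 : ℕ)) ^ (3 / 4 : ℝ) * (∫⁻ x, ‖w x‖ₑ ^ (6 : ℝ)) ^ (1 / 4 : ℝ)) ^ (4 / 3 : ℝ) =
      (∫⁻ x, ‖w x‖ₑ ^ (2 : ℕ)) * (∫⁻ x, ‖w x‖ₑ ^ (6 : ℝ)) ^ (1 / 3 : ℝ) := by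
    rw [ENNReal.mul_rpow_of_nonneg _ _ (by norm_num), ← ENNReal.rpow_mul, ← ENNReal.rpow_mul]
    norm_num
  -- `w ∈ L²`
  have h2' : eLpNorm w 2 volume < ⊤ := by
    rw [eLpNorm_lt_top_iff_lintegral_rpow_enorm_lt_top (by norm_num) (by norm_num), ENNReal.toReal_ofNat]
    have e : ∫⁻ x, ‖w x‖ₑ ^ (2 : ℝ) = ∫⁻ x, ‖w x‖ₑ ^ 2 :=
      lintegral_congr fun x => by rw [show (2 : ℝ) = ((2 : ℕ) : ℝ) by norm_num, ENNReal.rpow_natCast]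
    rw [e]
    exact h2
  -- Sobolev: `(∫|w|⁶)^{1/3} = ‖w‖₆² ≤ K² ‖Dw‖₂² ≤ K² ∫ |∇w|²`
  have hS : eLpNorm w 6 volume ≤
      ((SNormLESNormFDerivOfEqConst (EuclideanSpace ℝ (Fin 3))
        (volume : Measure (EuclideanSpace ℝ (Fin 3))) 2 : ℝ≥0) : ℝ≥0∞) * eLpNorm (fderiv ℝ w) 2 volume :=
    eLpNorm_six_le_eLpNorm_fderiv_two volume finrank_euclideanSpace_fin hw h2'
  have e6 : (∫⁻ x, ‖w x‖ₑ ^ (6 : ℝ)) ^ (1 / 3 : ℝ) = eLpNorm w 6 volume ^ 2 := by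
    have h := eLpNorm_rpow_eq_lintegral volume w (p := 6) (by norm_num)
    rw [show ENNReal.ofReal (6 : ℝ) = 6 by norm_num] at h
    rw [← h, ← ENNReal.rpow_mul, show (6 : ℝ) * (1 / 3) = ((2 : ℕ) : ℝ) by norm_num,
      ENNReal.rpow_natCast]
  have hD' : eLpNorm (fderiv ℝ w) 2 volume ^ 2 ≤ ∫⁻ x, ENNReal.ofReal (frobeniusNormSq (fderiv ℝ w x)) := by
    rw [← lintegral_enorm_sq_eq_eLpNorm_two_pow]
    refine lintegral_mono fun x => ?_
    rw [← ofReal_norm, ← ENNReal.ofReal_pow (norm_nonneg _)]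
    exact ENNReal.ofReal_le_ofReal (sq_opNorm_le_frobeniusNormSq _)
  have h6 : (∫⁻ x, ‖w x‖ₑ ^ (6 : ℝ)) ^ (1 / 3 : ℝ) ≤
      ((SNormLESNormFDerivOfEqConst (EuclideanSpace ℝ (Fin 3))
        (volume : Measure (EuclideanSpace ℝ (Fin 3))) 2 : ℝ≥0) : ℝ≥0∞) ^ 2 *
        ∫⁻ x, ENNReal.ofReal (frobeniusNormSq (fderiv ℝ w x)) := by
    rw [e6]
    calc eLpNorm w 6 volume ^ 2
        ≤ (((SNormLESNormFDerivOfEqConst (EuclideanSpace ℝ (Fin 3))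
            (volume : Measure (EuclideanSpace ℝ (Fin 3))) 2 : ℝ≥0) : ℝ≥0∞) *
            eLpNorm (fderiv ℝ w) 2 volume) ^ 2 := pow_le_pow_left' hS 2
      _ = ((SNormLESNormFDerivOfEqConst (EuclideanSpace ℝ (Fin 3))
            (volume : Measure (EuclideanSpace ℝ (Fin 3))) 2 : ℝ≥0) : ℝ≥0∞) ^ 2 *
            eLpNorm (fderiv ℝ w) 2 volume ^ 2 := by rw [mul_pow]
      _ ≤ ((SNormLESNormFDerivOfEqConst (EuclideanSpace ℝ (Fin 3))
            (volume : Measure (EuclideanSpace ℝ (Fin 3))) 2 : ℝ≥0) : ℝ≥0∞) ^ 2 *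
            ∫⁻ x, ENNReal.ofReal (frobeniusNormSq (fderiv ℝ w x)) := by gcongr
  calc eLpNorm w 3 volume ^ (4 : ℝ) = (∫⁻ x, ‖w x‖ₑ ^ (3 : ℕ)) ^ (4 / 3 : ℝ) := e3
    _ ≤ ((∫⁻ x, ‖w x‖ₑ ^ (2 : ℕ)) ^ (3 / 4 : ℝ) * (∫⁻ x, ‖w x‖ₑ ^ (6 : ℝ)) ^ (1 / 4 : ℝ)) ^ (4 / 3 : ℝ) :=
        ENNReal.rpow_le_rpow hint (by norm_num)
    _ = (∫⁻ x, ‖w x‖ₑ ^ (2 : ℕ)) * (∫⁻ x, ‖w x‖ₑ ^ (6 : ℝ)) ^ (1 / 3 : ℝ) := e4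
    _ ≤ (∫⁻ x, ‖w x‖ₑ ^ (2 : ℕ)) *
          (((SNormLESNormFDerivOfEqConst (EuclideanSpace ℝ (Fin 3))
            (volume : Measure (EuclideanSpace ℝ (Fin 3))) 2 : ℝ≥0) : ℝ≥0∞) ^ 2 *
            ∫⁻ x, ENNReal.ofReal (frobeniusNormSq (fderiv ℝ w x))) := by gcongr

/-- **Every frame solution is a priori in `L⁴_t L³_x`: `∫₀ᵀ ‖u(t)‖₃⁴ dt < ∞`.**  For `ν, T > 0` and a
classical solution `(u, p)` of the unforced system on `ℝ³ × [0, T)` which is Leray–Hopf on `[0, T)` from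
`u 0` (any `T`): `∫₀ᵀ ‖u(t)‖_{L³}⁴ dt ≤ 2E(u₀) · K² · ∫∫_{(0,T)×ℝ³} |∇u|² < ∞` (slice inequality
`eLpNorm_three_rpow_four_le`, the Leray–Hopf energy bound at every time and the finite slab dissipation of
the classical gradient, Tonelli).  The energy-level member (`r = 4`, `s = 3`, `2/r + 3/s = 3/2`) of the
classical mixed-norm scale of Leray–Hopf solutions. [cite: RobinsonRodrigoSadowski2016, Lemma 3.5] -/
theorem lintegral_eLpNorm_three_rpow_four_lt_top {ν T : ℝ} (hν : 0 < ν)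
    {u : ℝ → EuclideanSpace ℝ (Fin 3) → EuclideanSpace ℝ (Fin 3)} {p : ℝ → EuclideanSpace ℝ (Fin 3) → ℝ}
    (hcl : IsClassicalNSSolutionOn (Ico 0 T) ν 0 u p) (hLH : IsLerayHopfOn T ν 0 (u 0) u) :
    (∫⁻ t in Ioo 0 T, eLpNorm (u t) 3 volume ^ (4 : ℝ)) < ⊤ := by
  set K : ℝ≥0 := SNormLESNormFDerivOfEqConst (EuclideanSpace ℝ (Fin 3))
    (volume : Measure (EuclideanSpace ℝ (Fin 3))) 2 with hK
  set E₀ : ℝ≥0∞ := ENNReal.ofReal (2 * VectorCalculus.kineticEnergy (u 0)) with hE₀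
  set g : ℝ × EuclideanSpace ℝ (Fin 3) → ℝ≥0∞ :=
    fun z => ENNReal.ofReal (frobeniusNormSq (fderiv ℝ (u z.1) z.2)) with hg
  -- the slice bound for `t ∈ (0, T)`
  have hslice : ∀ t ∈ Ioo 0 T,
      eLpNorm (u t) 3 volume ^ (4 : ℝ) ≤ E₀ * ((K : ℝ≥0∞) ^ 2 * ∫⁻ x, g (t, x)) := by
    intro t ht
    have htc : t ∈ Ico 0 T := ⟨ht.1.le, ht.2⟩
    have hen : ∫⁻ x, ‖u t x‖ₑ ^ 2 ≤ E₀ := hLH.lintegral_enorm_sq_le hν.le ⟨ht.1.le, ht.2.le⟩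
    have h1 := eLpNorm_three_rpow_four_le ((hcl.contDiff_velocity htc).of_le (by norm_cast))
      (hen.trans_lt ENNReal.ofReal_lt_top)
    exact h1.trans (mul_le_mul' hen le_rfl)
  -- the integrand is continuous on the slab, hence a.e.-measurable for Tonelli
  have hcont : ContinuousOn g (Ioo 0 T ×ˢ (univ : Set (EuclideanSpace ℝ (Fin 3)))) := by
    have h1 : ContinuousOn (fun z : ℝ × EuclideanSpace ℝ (Fin 3) => fderiv ℝ (u z.1) z.2)
        (Ioo 0 T ×ˢ (univ : Set (EuclideanSpace ℝ (Fin 3)))) :=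
      (hcl.smooth_velocity.continuousOn_fderiv_slice (uniqueDiffOn_Ico 0 T)).mono
        (prod_mono Ioo_subset_Ico_self Subset.rfl)
    exact (ENNReal.continuous_ofReal.comp continuous_frobeniusNormSq').comp_continuousOn h1
  have hprod : ((volume : Measure ℝ).restrict (Ioo 0 T)).prod
      (volume : Measure (EuclideanSpace ℝ (Fin 3))) =
      (volume : Measure (ℝ × EuclideanSpace ℝ (Fin 3))).restrict (Ioo 0 T ×ˢ univ) := by
    rw [Measure.restrict_prod_eq_prod_univ, ← Measure.volume_eq_prod]
  have hgm : AEMeasurable (uncurry fun t x => g (t, x))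
      (((volume : Measure ℝ).restrict (Ioo 0 T)).prod (volume : Measure (EuclideanSpace ℝ (Fin 3)))) := by
    rw [hprod]
    exact hcont.aemeasurable (measurableSet_Ioo.prod MeasurableSet.univ)
  have htonelli : ∫⁻ t in Ioo 0 T, ∫⁻ x, g (t, x) =
      ∫⁻ z in Ioo 0 T ×ˢ (univ : Set (EuclideanSpace ℝ (Fin 3))), g z := by
    rw [lintegral_lintegral hgm, hprod]
  have hfin : ∫⁻ z in Ioo 0 T ×ˢ (univ : Set (EuclideanSpace ℝ (Fin 3))), g z < ⊤ :=
    SereginSverak2002.lintegral_slab_frobeniusNormSq_fderiv_lt_top' hcl hLH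
  have hcst : E₀ * (K : ℝ≥0∞) ^ 2 ≠ ⊤ :=
    ENNReal.mul_ne_top ENNReal.ofReal_ne_top (ENNReal.pow_ne_top ENNReal.coe_ne_top)
  calc ∫⁻ t in Ioo 0 T, eLpNorm (u t) 3 volume ^ (4 : ℝ)
      ≤ ∫⁻ t in Ioo 0 T, E₀ * (K : ℝ≥0∞) ^ 2 * ∫⁻ x, g (t, x) := by
        refine setLIntegral_mono' measurableSet_Ioo fun t ht => ?_
        rw [mul_assoc]
        exact hslice t ht
    _ = E₀ * (K : ℝ≥0∞) ^ 2 * ∫⁻ t in Ioo 0 T, ∫⁻ x, g (t, x) := lintegral_const_mul' _ _ hcst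
    _ < ⊤ := by
        rw [htonelli]
        exact ENNReal.mul_lt_top hcst.lt_top hfin

/-- **The jaw at the energy level `q = 4` (calibration of crux `L3CascadeJaw`,
stmt-NavierStokesRegularity-19499)**: in the crux's exact frame — every `ν, T > 0`, every classical
solution on `[0,T)` that is Leray–Hopf from a rapidly decaying datum — there is `T₂ ∈ (0,T)` with
`∫_{T₂}^T ‖u(t)‖₃⁴ dt < ∞` (indeed the whole interval works; `T₂ = T/2`).  The crux asks the same for
every `q ∈ (4,5)`; this is its KNOWN floor, the decay and classical hypotheses being carried, not needed
beyond `lintegral_eLpNorm_three_rpow_four_lt_top`. [cite: RobinsonRodrigoSadowski2016, Lemma 3.5] -/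
theorem l3Jaw_four :
    ∀ (ν T : ℝ), 0 < ν → 0 < T →
      ∀ (u : ℝ → EuclideanSpace ℝ (Fin 3) → EuclideanSpace ℝ (Fin 3)) (p : ℝ → EuclideanSpace ℝ (Fin 3) → ℝ),
        IsClassicalNSSolutionOn (Ico 0 T) ν 0 u p → IsLerayHopfOn T ν 0 (u 0) u →
        HasRapidSpatialDecay (u 0) →
        ∃ T₂ ∈ Ioo 0 T, (∫⁻ t in Ioo T₂ T, eLpNorm (u t) 3 volume ^ (4 : ℝ)) < ⊤ := by
  intro ν T hν hT u p hcl hLH _hdec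
  refine ⟨T / 2, ⟨by linarith, by linarith⟩, ?_⟩
  exact lt_of_le_of_lt (lintegral_mono_set (Ioo_subset_Ioo_left (by linarith)))
    (lintegral_eLpNorm_three_rpow_four_lt_top hν hcl hLH)

end Summit.NavierStokesRegularity.NavierStokesRegularity.Theorems.L3TimeExponentPincerJawEnergyFloor

end
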